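import Summits.ResolutionOfSingularities.ResolutionOfSingularities.Theorems.HilbertSamuelEliminationSigmaMaxModificationsCorridor3WLadderIsoInsepE2Stalk
import Summits.ResolutionOfSingularities.ResolutionOfSingularities.Theorems.FrobeniusClosingSteerLowOrderDetector
import Literature.AlgebraicGeometry.Resolution.RegularSystemOfParameters
import HarnessLib

/-!
# [OURS · L1 W4.2] E2 chart calculus, brick 5: E2-ADAPTED REGULAR PARAMETERS — an E2 stage has a hypersurface presentation `σ : R ↠ 𝒪_{X,x}`
# with regular parameters `c = (x, y, z, w)` and `h ≡ ĉ(x² + λ̂y²) (mod 𝔪³)`, `λ̄ ∉ κ²` (crux chain w42, cell k2 `T3insep` =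
# `stub_isoInsepTower`; `--supports stmt-ResolutionOfSingularities-19249`)

OURS (cell res-hironaka, slot W4.2, seat res-D-pv-042; OWN OBJECT TUO 15:58Z); NOT a statement of [Hironaka2017] nor of
[CossartJannsenSaito2020] / [CossartPiltant2008]. AI-drafted, weaker than expert review. PROOF file, def-free, fact-free.

* `linearIndependent_toCotangent_pair` — for a regular system of parameters `y` and two combinations `x₀ = Σ ŝᵢyᵢ`, `x₁ = Σ t̂ᵢyᵢ` whose
  coefficient vectors are residually independent, the classes of `x₀, x₁` in `𝔪/𝔪²` are linearly independent (quasi-regularity: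
  Literature `coeff_mem_maximalIdeal_of_eval_mem_pow`).
* `exists_rsop_e2Shape_of_isFormalDoublePointAt` — brick 4 re-coordinatised: for an E2 point (formal double point, `e = 2`, `ē = 3`, residue
  characteristic two, `X` locally of finite type over a field) there are `R` regular local of embedding dimension `4`, REGULAR PARAMETERS
  `c : Fin 4 → R`, `σ : R ↠ 𝒪_{X,x}` with `ker σ = (h)`, `h ∈ 𝔪² ∖ 𝔪³`, a unit `ĉ` and `λ̂` with non-square residue such that
  **`h − ĉ·(c 0 ² + λ̂·c 1 ²) ∈ 𝔪³`** — the input shape of res-type-071's `EmbeddedStep.exists_stalk_presentation_tower` for the chart lemmas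
  (N2)/(N3) of the NJ/RC dictionary (`SwitchingDichotomy.LowOrderDetector.exists_rsop_extending` extends `(x₀, x₁)` to regular parameters).
-/

noncomputable section

set_option linter.dupNamespace false

open scoped Classical
open CategoryTheory AlgebraicGeometry TopologicalSpace IsLocalRing MvPolynomial Module
open Literature.RingTheory.MvPolynomial Literature.RingTheory.HilbertSamuel Literature.AlgebraicGeometry.Resolution
open Summit.ResolutionOfSingularities.ResolutionOfSingularities.Theorems.SwitchingDichotomy.LowOrderDetector (exists_rsop_extending)

namespace Summit.ResolutionOfSingularities.ResolutionOfSingularities.Cruxes.SigmaMaxModifications.IdeasL1C6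

universe u

/-- **Quasi-regularity read in the cotangent space.** For a regular local ring `R` with regular parameters `y : Fin d → R` and coefficient
vectors `ŝ, t̂ : Fin d → R` whose residues are linearly independent, the classes of `Σ ŝᵢyᵢ` and `Σ t̂ᵢyᵢ` in `𝔪/𝔪²` are linearly independent
over the residue field. [folklore] -/
theorem linearIndependent_toCotangent_pair {R : Type u} [CommRing R] [IsRegularLocalRing R] {d : ℕ}
    (hd : (maximalIdeal R).spanFinrank = d) (y : Fin d → R) (hy : Ideal.span (Set.range y) = maximalIdeal R) (s t : Fin d → R)
    (hst : ∀ a b : ResidueField R, (∀ i, a * residue R (s i) + b * residue R (t i) = 0) → a = 0 ∧ b = 0)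
    (hw : ∀ i : Fin 2, (![∑ i, s i * y i, ∑ i, t i * y i] i) ∈ maximalIdeal R) :
    LinearIndependent (ResidueField R) fun i : Fin 2 => (maximalIdeal R).toCotangent ⟨![∑ i, s i * y i, ∑ i, t i * y i] i, hw i⟩ := by
  rw [Fintype.linearIndependent_iff]
  intro g hg
  -- lift the coefficients
  obtain ⟨r₀, hr₀⟩ := Ideal.Quotient.mk_surjective (g 0)
  obtain ⟨r₁, hr₁⟩ := Ideal.Quotient.mk_surjective (g 1)
  have hres : ∀ (r : R) (v : (maximalIdeal R).Cotangent), (residue R r) • v = r • v := fun r v =>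
    algebraMap_smul (ResidueField R) r v
  rw [Fin.sum_univ_two, ← hr₀, ← hr₁] at hg
  change (residue R r₀) • _ + (residue R r₁) • _ = 0 at hg
  rw [hres, hres, ← map_smul, ← map_smul, ← map_add, Ideal.toCotangent_eq_zero] at hg
  -- `r₀ x₀ + r₁ x₁ ∈ 𝔪²`, as the value of the linear form with coefficients `r₀ ŝᵢ + r₁ t̂ᵢ`
  have hval : (((r₀ • (⟨_, hw 0⟩ : maximalIdeal R) + r₁ • (⟨_, hw 1⟩ : maximalIdeal R) : maximalIdeal R)) : R) =
      eval y (∑ i, C (r₀ * s i + r₁ * t i) * X i) := by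
    simp only [Submodule.coe_add, Submodule.coe_smul_of_tower, smul_eq_mul, Matrix.cons_val_zero, Matrix.cons_val_one,
      map_sum, map_mul, eval_C, eval_X, Finset.mul_sum, ← Finset.sum_add_distrib]
    refine Finset.sum_congr rfl fun i _ => by ring
  rw [hval] at hg
  have hcoeff := fun m => coeff_mem_maximalIdeal_of_eval_mem_pow hd y hy (isHomogeneous_sum_C_mul_X fun i => r₀ * s i + r₁ * t i) hg m
  have hzero : ∀ i, residue R r₀ * residue R (s i) + residue R r₁ * residue R (t i) = 0 := by
    intro i
    have h := hcoeff (Finsupp.single i 1)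
    rw [← residue_eq_zero_iff] at h
    have hc : coeff (Finsupp.single i 1) (∑ j, C (r₀ * s j + r₁ * t j) * X j : MvPolynomial (Fin d) R) = r₀ * s i + r₁ * t i := by
      rw [coeff_sum, Finset.sum_eq_single i]
      · rw [coeff_C_mul, coeff_X, if_pos rfl, mul_one]
      · intro j _ hj
        rw [coeff_C_mul, coeff_X, if_neg, mul_zero]
        intro h'; exact hj (Finsupp.single_left_injective one_ne_zero h')
      · intro h'; exact absurd (Finset.mem_univ i) h'
    rw [hc, map_add, map_mul, map_mul] at h
    exact h
  obtain ⟨h0, h1⟩ := hst _ _ hzero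
  refine Fin.forall_fin_two.mpr ⟨?_, ?_⟩
  · rw [← hr₀]; exact h0
  · rw [← hr₁]; exact h1

/-- **E2-ADAPTED REGULAR PARAMETERS.** For `X` locally of finite type over a field `k` of characteristic two and an E2 point `x`
(`IsFormalDoublePointAt X x`, `Scheme.dirDim X x = 2`, `Scheme.geomDirDim X x = 3`): a hypersurface presentation `σ : R ↠ 𝒪_{X,x}` from a
regular local ring of embedding dimension `4` with REGULAR PARAMETERS `c : Fin 4 → R` such that `ker σ = (h)`, `h ∈ 𝔪² ∖ 𝔪³` and
`h − ĉ·(c 0 ² + λ̂·c 1 ²) ∈ 𝔪³` with `ĉ` a unit and the residue of `λ̂` not a square — the coordinates `(x, y, z, w) = (c 0, c 1, c 2, c 3)` in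
which the E2 stage reads `h ≡ ĉ(x² + λ̂y²) (mod 𝔪³)`. [OURS · L1 W4.2 · k2 · E2 chart calculus, brick 5] [folklore] -/
theorem exists_rsop_e2Shape_of_isFormalDoublePointAt {k : Type} [Field k] [CharP k 2] {X : Scheme.{0}} (f : X ⟶ Spec (.of k))
    [LocallyOfFiniteType f] [IsLocallyNoetherian X] (x : X) (hdp : IsFormalDoublePointAt X x) (he : Scheme.dirDim X x = 2)
    (hgeom : Scheme.geomDirDim X x = 3) :
    ∃ (R : Type) (_ : CommRing R) (_ : IsRegularLocalRing R) (c : Fin 4 → R) (σ : R →+* X.presheaf.stalk x) (h cc lam : R),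
      (maximalIdeal R).spanFinrank = 4 ∧ Ideal.span (Set.range c) = maximalIdeal R ∧ Function.Surjective σ ∧
      RingHom.ker σ = Ideal.span {h} ∧ h ∈ maximalIdeal R ^ 2 ∧ h ∉ maximalIdeal R ^ 3 ∧
      cc ∉ maximalIdeal R ∧ (∀ u : R, u ^ 2 - lam ∉ maximalIdeal R) ∧
      h - cc * (c 0 ^ 2 + lam * c 1 ^ 2) ∈ maximalIdeal R ^ 3 := by
  obtain ⟨R, _, _, y, σ, h, s, t, cc, lam, h4, hy, hσ, hker, hh2, hh3, hst, hcc, hlam, hshape⟩ :=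
    exists_e2Shape_of_isFormalDoublePointAt f x hdp he hgeom
  -- the two combinations lie in `𝔪` and are independent in `𝔪/𝔪²`
  have hyi : ∀ i, y i ∈ maximalIdeal R := fun i => hy ▸ Ideal.subset_span ⟨i, rfl⟩
  have hw : ∀ i : Fin 2, (![∑ i, s i * y i, ∑ i, t i * y i] i) ∈ maximalIdeal R := by
    refine Fin.forall_fin_two.mpr ⟨?_, ?_⟩ <;> simp only [Matrix.cons_val_zero, Matrix.cons_val_one] <;>
      exact Ideal.sum_mem _ fun i _ => Ideal.mul_mem_left _ _ (hyi i)
  have hli := linearIndependent_toCotangent_pair h4 y hy s t hst hw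
  obtain ⟨e, c, hde, hc, hcw⟩ := exists_rsop_extending _ hw hli
  have he2 : e = 2 := by omega
  subst he2
  refine ⟨R, inferInstance, inferInstance, c, σ, h, cc, lam, h4, hc, hσ, hker, hh2, hh3, hcc, hlam, ?_⟩
  have h0 : c 0 = ∑ i, s i * y i := by
    have := hcw 0; simpa using this
  have h1 : c 1 = ∑ i, t i * y i := by
    have := hcw 1; simpa using this
  rw [h0, h1]
  exact hshape

end Summit.ResolutionOfSingularities.ResolutionOfSingularities.Cruxes.SigmaMaxModifications.IdeasL1C6

end
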